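import Summits.QuantumFields.YangMills.Theorems.BalabanUVNodesN06XdLegAtPinsPhysRU

/-!
# BalabanUVNodes ∕ N06 ([B9], `Dag.B9_main`) — ROWS 20–21's MIXED LETTERS `dgDH` (∇_UG₀D_U : `bH13 x U → 𝔠_Y⁽¹⁾`) AND `dgDHd ν` (∇_{U,ν}G₀D_U : `bH13 x U → 𝔠⁽¹⁾`) of the records
# `Letters313DZ ∕ Letters313DMZ` DERIVED ABOVE A CLOSED THRESHOLD from the displayed (3.44) members `h44m`, the plaquette binder `hF` and the member facts
# (dag-n06-l's `dgDH_of_pins ∕ dgDHd_of_pins` (p661566 (R4)) with `Facts347 ∕ RowSum` discharged at the geometry of record; input of the `hlettersD13`-split edition)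

Track A of `YM-PLAN.md` (cell `pub-ymgap`, HUMAN RULING D-0062), node **N06** = [Balaban1985BackgroundPropagators] Thms 3.1–3.15; seat `pub-ymgap-dag-n06-d`
(gen 15).  WHY (dag-n06-l `ED47-REPLACEMENT-TABLE.md` row `hlettersD13` — SPLIT: keep `dgQs rgdH dgQsd pQd` displayed, DERIVE `dgDH dgDHd`).  The certificate displays
`hlettersD13 : … → Letters313DZ (𝔬12 x) 1 (H x) … B12₃ δ12₃ (bH13 x U) U ∧ Letters313DMZ (𝔬12 x) (𝔭A x) (𝔡A x).Dd 1 (H x) … B12₃ Bq12 δ12₃ (bH13 x U) U`; the fields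
`dgDH` ∕ `dgDHd ν` are the (3.44)-type Hölder entries of `∇_UG₀D_U` ∕ `∇_{U,ν}G₀D_U` INTO the graded transported site class.  dag-n06-l's member-∀ faces derive them from
the PRINTED (3.44) members `h44m ν μ : HasMaj (bHZKT (taxiB U) s 1) (ofBlocks blk) (∇_{U,ν} ∘ G₀ ∘ D*_{U,μ}) (Bi·e^{−δ44 d})` at ONE fixed exponent `s ∈ (0,1)` with `0 < w13 s`,
`hF`, the pins and `Facts347 ∕ RowSum` (hypotheses there).  THIS FILE discharges the member facts and CHOOSES the rates exactly as `N06XdLegAtPinsPhysRU` (`α := 1∕2`,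
`δF := δ44 − δ₃`, `σ := 1`, `δJ := δ₃ + 1 + δF∕2`), with CLOSED constants `B3d := (d+1)·((1+C_Lip)·(Bi·L)·(CJG d ℓ (trBasis N) 1 (thetaL d ℓ ϑF) (w13 s) δJ·L)·cσ)` and
`cσ := rowConst261 geo9Y 1` (dag-n06-i's NAMED (2.61) constant, so every constant below is a CLOSED term): ★★ `dgDH_dgDHd_of_pins_geo9Y : ∃ MDg, ∀ x, MDg ≤ M → … →
(∀ ν, dgDHd-shape at B₃, rate δ₃) ∧ (dgDH-shape at B₃, rate δ₃)` for ANY `0 ≤ δ₃ < δ44` and ANY displayed constant `B₃` above the two closed thresholds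
`hB3d : B3d ≤ B₃`, `hB3p : (d+1)·(1·B3d·cσ) ≤ B₃` — the edition takes `δ₃ := δ12₃`, `B₃ := B12₃` and displays `hB3d hB3p` as numeric side conditions.
HONEST FRAMING.  Kernel bookkeeping (∃-packaging of landed member-∀ theorems with landed member-fact theorems and explicit rate choices); the (3.44) members `h44m` and
the plaquette binder `hF` are HYPOTHESES; nothing of [B9] asserted; COUNT-NEUTRAL; N06 NOT discharged; K1⁹ NOT closed; one finite 𝕋⁴ programme at fixed `ε` — NOT continuum ∕ OS ∕
mass gap ∕ Clay.  0 `def`, 0 `sorry`.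
-/

noncomputable section

namespace Summit.QuantumFields.YangMills.BalabanUVNodes.N06DgLegAtPinsPhysRU

open Literature.MathematicalPhysics.QuantumFieldTheory.Balaban1983to89
open Literature.MathematicalPhysics.QuantumFieldTheory.Balaban1983to89.Node00 (FBondY IBondY SiteY levY toKT CfgY)
open Literature.MathematicalPhysics.QuantumFieldTheory.Balaban1983to89.B9Thm34Ext (toB6)
open Literature.MathematicalPhysics.QuantumFieldTheory.Balaban1983to89.B11SectG (HasMaj BlockNorm RowSum)
open Literature.MathematicalPhysics.QuantumFieldTheory.Balaban1983to89.B9SectDSup (weightNorm)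
open Literature.MathematicalPhysics.QuantumFieldTheory.Balaban1983to89.B9Thm312Whole (cNorm GeoOK)
open Literature.MathematicalPhysics.QuantumFieldTheory.Balaban1983to89.B9Thm312WholeClasses (cNormR)
open Literature.MathematicalPhysics.QuantumFieldTheory.Balaban1983to89.B9RWSums343Holder (HolderProbes)
open Literature.MathematicalPhysics.QuantumFieldTheory.Balaban1983to89.B9RWSums343to347Whole (Facts347)
open Literature.MathematicalPhysics.QuantumFieldTheory.Balaban1983to89.B9RWSums346SecondDiff (DirOps310)
open Literature.MathematicalPhysics.QuantumFieldTheory.Balaban1983to89.B9Thm310Whole (Ops310)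
open Literature.MathematicalPhysics.QuantumFieldTheory.Balaban1983to89.B9CoReadingCoords (coordOpK XBK blkBK cdBₗ cdsBₗ DcoK)
open Literature.MathematicalPhysics.QuantumFieldTheory.Balaban1983to89.B9CoReadingCoordsS (XSK sIK)
open Literature.MathematicalPhysics.QuantumFieldTheory.Balaban1983to89.B9CoReadingCoordsH (XHK)
open Literature.MathematicalPhysics.QuantumFieldTheory.Balaban1983to89.B9CoReadingCoordsHolder (PK)
open Literature.MathematicalPhysics.QuantumFieldTheory.Balaban1983to89.B9CoReadingCoordsTranspose (TrIdx trBasis)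
open Literature.MathematicalPhysics.QuantumFieldTheory.Balaban1983to89.B9PinMembersKLevelV1 (MemberY geo9Y bg9Y)
open Literature.MathematicalPhysics.QuantumFieldTheory.Balaban1983to89.B9BackgroundsKLevelV1R (RegFamY bg9YR MemOfFam mem_of_reg335R)
open Literature.MathematicalPhysics.QuantumFieldTheory.Balaban1983to89.B9GeoLemma21KLevelV1 (geo9Y_len_pos geo9Y_dist_triangle geo9Y_dist_comm rowSum261_geo9Y)
open Literature.MathematicalPhysics.QuantumFieldTheory.Balaban1983to89.B9GeoNormsKLevelV1 (geo9K geo9K_dist_nonneg)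
open Literature.MathematicalPhysics.QuantumFieldTheory.Balaban1983to89.B7Prop2SpecialUnitary (specialUnitaryUnits)
open Literature.MathematicalPhysics.QuantumFieldTheory.Balaban1983to89.B9RWSums347DefiniteFaces (exp261 facts347_exp261_geo9Y geo9Y_scalars)
open Literature.MathematicalPhysics.QuantumFieldTheory.Balaban1983to89.B9RowSum261DefiniteFaces (rowConst261 rowConst261_nonneg rowConst261_spec_of_rowSum261)
open B6GlobalChartV1 (PV blkV1) open B6Ineq2142KLevelV1 (β lvl) open B6Geom246MultiLevelTorus (geomT)
open Node00.OpsYSectDCoords (DvcoKH) open Node00.OpsYNablaBridge (chartY)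
open B9MultiscaleSmoothPartitionYLip (CLip) open B9SmoothHolderClassT (bHZT bHZKT)
open B9SmoothHolderClassGraded (bHZG bHZKG) open B9GradViaDivLettersTransported (taxiS taxiB)
open Literature.MathematicalPhysics.QuantumFieldTheory.Balaban1983to89.B9Thm313WholeDvHolderAtPinsGraded (thetaL CJG thetaL_nonneg CJG_nonneg)
open Literature.MathematicalPhysics.QuantumFieldTheory.Balaban1983to89.B9TaxiTransportLadder (plaqV)
open Summit.QuantumFields.YangMills.BalabanUVNodes.N06HolderPinsGradedAtRecord (dgDH_of_pins dgDHd_of_pins)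
open Summit.QuantumFields.YangMills.BalabanUVNodes.N06XdLegAtPinsPhysRU (one_le_CLip)
open scoped Matrix.Norms.L2Operator

variable {N : ℕ} {d ℓ : ℕ} {hd : 1 ≤ d + 1} {hL : Odd (ℓ + 1) ∧ 1 < ℓ + 1} {b₀ b₁ : ℝ} {Mstar : ℕ}

/-- ★★ **`dgDH` AND `dgDHd` DERIVED ABOVE A CLOSED THRESHOLD** (module docstring): for any target rate `0 ≤ δ₃ < δ44`, from the displayed (3.44) members `h44m` (rate
`δ44`, constant `Bi`, exponent `s`), the plaquette binder `hF` (budget `ϑF ≥ 0`) and the pins, and any constant `B₃` above the two CLOSED thresholds `hB3d hB3p`, there is a threshold `MDg` with the `dgDHd ν` and `dgDH` fields of `Letters313DMZ ∕ Letters313DZ`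
at constant `B₃` and rate `δ₃` for every member above `MDg`.
[cite: Balaban1985BackgroundPropagators, Thm 3.13 p.426 + Thm 3.3 (3.44) p.398 + (3.152)–(3.153) p.426 + (3.40) p.397 + (3.35) p.396 + p.398 (remark after (3.47)); Balaban1984PropagatorsII, (2.26) p.228 + (2.52)–(2.56) pp.232–233 + Lemma 2.1 (2.59)–(2.61) pp.233–234] -/
theorem dgDH_dgDHd_of_pins_geo9Y [NeZero N] [∀ x : MemberY d ℓ hd hL b₀ b₁ Mstar, Fintype (geo9Y x).Site]
    {R₁ R₂ : RegFamY d ℓ hd hL b₀ b₁ Mstar (Matrix (Fin N) (Fin N) ℂ)} (H : MemberY d ℓ hd hL b₀ b₁ Mstar → Prop)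
    (bI : ∀ x : MemberY d ℓ hd hL b₀ b₁ Mstar, FBondY x.toKIdx → IBondY x.toKIdx)
    (hβ1 : ∀ (x : MemberY d ℓ hd hL b₀ b₁ Mstar) (f : FBondY x.toKIdx), (geomT x.D).dist (β x.hN x.D x.hk (bI x f)) (blkV1 x.hN x.D f) ≤ 1)
    (hbI0 : ∀ (x : MemberY d ℓ hd hL b₀ b₁ Mstar) (f : FBondY x.toKIdx), bI x f = bI x ⟨f.src, 0⟩)
    (hGR : MemOfFam (specialUnitaryUnits (Fin N)) R₁) (c : ℝ) {M₀ a₀ : ℝ} {ϑF : ℝ} (hϑF : 0 ≤ ϑF)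
    (hF : ∀ x : MemberY d ℓ hd hL b₀ b₁ Mstar, letI : Fintype (geo9K x.toKIdx).Site := (inferInstance : Fintype (geo9Y x).Site); M₀ ≤ (geo9Y x).M → ∀ α₀ : ℝ, 0 < α₀ → (geo9Y x).M * α₀ ≤ a₀ → ∀ U : (bg9YR (Matrix (Fin N) (Fin N) ℂ) (specialUnitaryUnits (Fin N)) R₁ R₂ x).Cfg, (bg9YR (Matrix (Fin N) (Fin N) ℂ) (specialUnitaryUnits (Fin N)) R₁ R₂ x).Reg335 c α₀ U →
      (bg9YR (Matrix (Fin N) (Fin N) ℂ) (specialUnitaryUnits (Fin N)) R₁ R₂ x).Reg336 c α₀ U → ∀ (y : Site (PV d ℓ x.m x.K hd hL) 0) (μ' ν' : Fin (d + 1)),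
        ‖(plaqV U y μ' ν' : Matrix (Fin N) (Fin N) ℂ) - 1‖ ≤ ϑF * (((((ℓ + 1 : ℕ) : ℝ)) ^ levY x.toKIdx (chartY x.toKIdx y))⁻¹))
    (w13 : ℝ → ℝ) (hw13₀ : ∀ s, 0 ≤ w13 s) (hw13₁ : ∀ s, w13 s ≤ 1) {s : ℝ} (hs0 : 0 < s) (hs1 : s < 1) (hws : 0 < w13 s)
    (bH13 : ∀ x : MemberY d ℓ hd hL b₀ b₁ Mstar, (bg9YR (Matrix (Fin N) (Fin N) ℂ) (specialUnitaryUnits (Fin N)) R₁ R₂ x).Cfg → BlockNorm (toB6 (geo9Y x) 1 (H x)) (XSK (TrIdx N) x.toKIdx → ℝ))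
    (hbH13 : ∀ (x : MemberY d ℓ hd hL b₀ b₁ Mstar) (U : (bg9YR (Matrix (Fin N) (Fin N) ℂ) (specialUnitaryUnits (Fin N)) R₁ R₂ x).Cfg), bH13 x U =
      letI : Fintype (geo9K x.toKIdx).Site := (inferInstance : Fintype (geo9Y x).Site);
      weightNorm (bHZG (κ := TrIdx N) x.toKIdx (trBasis N) (taxiS x.toKIdx (bg9YR (Matrix (Fin N) (Fin N) ℂ) (specialUnitaryUnits (Fin N)) R₁ R₂ x) (fun U => U) U) (R := (1 : ℝ)) (H := H x) le_rfl w13 hw13₀ hw13₁)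
        (fun y => ((geo9Y x).len y)⁻¹) (fun y => inv_nonneg.2 (geo9Y_len_pos x y).le))
    {ιA AA : MemberY d ℓ hd hL b₀ b₁ Mstar → Type}
    (𝔬A : ∀ x : MemberY d ℓ hd hL b₀ b₁ Mstar, Ops310 (geo9Y x) (bg9YR (Matrix (Fin N) (Fin N) ℂ) (specialUnitaryUnits (Fin N)) R₁ R₂ x) (XBK (TrIdx N) x.toKIdx) (XBK (TrIdx N) x.toKIdx) (ιA x) (AA x))
    (𝔬12 : ∀ x : MemberY d ℓ hd hL b₀ b₁ Mstar, B9Thm312Whole.Ops (geo9Y x) (bg9YR (Matrix (Fin N) (Fin N) ℂ) (specialUnitaryUnits (Fin N)) R₁ R₂ x) (XBK (TrIdx N) x.toKIdx) (XBK (TrIdx N) x.toKIdx) (XHK (TrIdx N) x.toKIdx) (XSK (TrIdx N) x.toKIdx))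
    (hDvco12 : ∀ (x : MemberY d ℓ hd hL b₀ b₁ Mstar) (U : (bg9YR (Matrix (Fin N) (Fin N) ℂ) (specialUnitaryUnits (Fin N)) R₁ R₂ x).Cfg), (𝔬12 x).Dv U = DvcoKH x.toKIdx (trBasis N) (bg9YR (Matrix (Fin N) (Fin N) ℂ) (specialUnitaryUnits (Fin N)) R₁ R₂ x) (fun U => U) U)
    (𝔡A : ∀ x : MemberY d ℓ hd hL b₀ b₁ Mstar, DirOps310 (𝔬A x) (Fin (d + 1)))
    (h𝔡As : ∀ (x : MemberY d ℓ hd hL b₀ b₁ Mstar) (U : (bg9YR (Matrix (Fin N) (Fin N) ℂ) (specialUnitaryUnits (Fin N)) R₁ R₂ x).Cfg), (𝔡A x).Dsd U = fun μ => coordOpK (trBasis N) (fun _ : Fin (d + 1) => cdsBₗ x.toKIdx U μ))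
    (h𝔡Ad : ∀ (x : MemberY d ℓ hd hL b₀ b₁ Mstar) (U : (bg9YR (Matrix (Fin N) (Fin N) ℂ) (specialUnitaryUnits (Fin N)) R₁ R₂ x).Cfg), (𝔡A x).Dd U = fun μ => coordOpK (trBasis N) (fun _ : Fin (d + 1) => cdBₗ x.toKIdx U μ))
    (hblk12 : ∀ x : MemberY d ℓ hd hL b₀ b₁ Mstar, (𝔬12 x).blk = blkBK x.toKIdx (bI x)) (hblkY12 : ∀ x : MemberY d ℓ hd hL b₀ b₁ Mstar, (𝔬12 x).blkY = blkBK x.toKIdx (bI x))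
    (hDco12 : ∀ (x : MemberY d ℓ hd hL b₀ b₁ Mstar) (U : (bg9YR (Matrix (Fin N) (Fin N) ℂ) (specialUnitaryUnits (Fin N)) R₁ R₂ x).Cfg), (𝔬12 x).D U = DcoK x.toKIdx (trBasis N) (bg9YR (Matrix (Fin N) (Fin N) ℂ) (specialUnitaryUnits (Fin N)) R₁ R₂ x) (fun U => U) U)
    {δ44 δ₃ : ℝ} (hδ₃ : 0 ≤ δ₃) (hδ : δ₃ < δ44) {Bi : ℝ} (hBi : 0 ≤ Bi) {B₃ : ℝ}
    (hB3d : ((d : ℝ) + 1) * ((1 + CLip d ℓ) * (Bi * (((ℓ + 1 : ℕ) : ℝ))) * (CJG d ℓ (trBasis N) 1 (thetaL d ℓ ϑF) (w13 s) (δ₃ + 1 + 1 / 2 * (δ44 - δ₃)) * (((ℓ + 1 : ℕ) : ℝ))) * rowConst261 (@geo9Y d ℓ hd hL b₀ b₁ Mstar) 1) ≤ B₃)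
    (hB3p : ((d : ℝ) + 1) * (1 * (((d : ℝ) + 1) * ((1 + CLip d ℓ) * (Bi * (((ℓ + 1 : ℕ) : ℝ))) * (CJG d ℓ (trBasis N) 1 (thetaL d ℓ ϑF) (w13 s) (δ₃ + 1 + 1 / 2 * (δ44 - δ₃)) * (((ℓ + 1 : ℕ) : ℝ))) * rowConst261 (@geo9Y d ℓ hd hL b₀ b₁ Mstar) 1)) * rowConst261 (@geo9Y d ℓ hd hL b₀ b₁ Mstar) 1) ≤ B₃)
    (h44m : ∀ x : MemberY d ℓ hd hL b₀ b₁ Mstar, letI : Fintype (geo9K x.toKIdx).Site := (inferInstance : Fintype (geo9Y x).Site); M₀ ≤ (geo9Y x).M → ∀ α₀ : ℝ, 0 < α₀ → (geo9Y x).M * α₀ ≤ a₀ → ∀ U : (bg9YR (Matrix (Fin N) (Fin N) ℂ) (specialUnitaryUnits (Fin N)) R₁ R₂ x).Cfg, (bg9YR (Matrix (Fin N) (Fin N) ℂ) (specialUnitaryUnits (Fin N)) R₁ R₂ x).Reg335 c α₀ U →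
      (bg9YR (Matrix (Fin N) (Fin N) ℂ) (specialUnitaryUnits (Fin N)) R₁ R₂ x).Reg336 c α₀ U → ∀ ν μ : Fin (d + 1),
        HasMaj (bHZKT (κ := TrIdx N) x.toKIdx (trBasis N) (taxiB x.toKIdx (bg9YR (Matrix (Fin N) (Fin N) ℂ) (specialUnitaryUnits (Fin N)) R₁ R₂ x) (fun U => U) U) (R := (1 : ℝ)) (H := H x) hs0.le hs1.le hs1.le) (BlockNorm.ofBlocks (toB6 (geo9Y x) 1 (H x)) (𝔬12 x).blk)
          ((𝔡A x).Dd U ν ∘ₗ ((𝔬12 x).G0 U ∘ₗ (𝔡A x).Dsd U μ)) (fun a a' => Bi * Real.exp (-(δ44 * (geo9Y x).dist a a')))) :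
    ∃ MDg : ℝ, ∀ x : MemberY d ℓ hd hL b₀ b₁ Mstar, MDg ≤ (geo9Y x).M → ∀ α₀ : ℝ, 0 < α₀ → (geo9Y x).M * α₀ ≤ a₀ →
        ∀ U : (bg9YR (Matrix (Fin N) (Fin N) ℂ) (specialUnitaryUnits (Fin N)) R₁ R₂ x).Cfg, (bg9YR (Matrix (Fin N) (Fin N) ℂ) (specialUnitaryUnits (Fin N)) R₁ R₂ x).Reg335 c α₀ U → (bg9YR (Matrix (Fin N) (Fin N) ℂ) (specialUnitaryUnits (Fin N)) R₁ R₂ x).Reg336 c α₀ U →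
          (∀ ν : Fin (d + 1), HasMaj (bH13 x U) (cNorm 1 (H x) (𝔬12 x).blk (fun y => (geo9Y_len_pos x y).le) 1) ((𝔡A x).Dd U ν ∘ₗ (𝔬12 x).G0 U ∘ₗ (𝔬12 x).Dv U)
              (fun a a' => B₃ * Real.exp (-(δ₃ * (geo9Y x).dist a a')))) ∧
          HasMaj (bH13 x U) (cNorm 1 (H x) (𝔬12 x).blkY (fun y => (geo9Y_len_pos x y).le) 1) ((𝔬12 x).D U ∘ₗ (𝔬12 x).G0 U ∘ₗ (𝔬12 x).Dv U)
            (fun a a' => B₃ * Real.exp (-(δ₃ * (geo9Y x).dist a a'))) := by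
  have hδF : 0 < δ44 - δ₃ := sub_pos.2 hδ
  obtain ⟨Mg, hFa⟩ := facts347_exp261_geo9Y (d := d) (ℓ := ℓ) (hd := hd) (hL := hL) (b₀ := b₀) (b₁ := b₁) (Mstar := Mstar) H
    (α := 1 / 2) (by norm_num) (by norm_num) hδF
  obtain ⟨ML, hrow⟩ := rowConst261_spec_of_rowSum261 (rowSum261_geo9Y (d := d) (ℓ := ℓ) (hd := hd) (hL := hL) (b₀ := b₀) (b₁ := b₁) (Mstar := Mstar)) one_pos
  set L₀ : ℝ := ((ℓ + 1 : ℕ) : ℝ) with hL₀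
  set δJ : ℝ := δ₃ + 1 + 1 / 2 * (δ44 - δ₃) with hδJ
  have hδJ0 : 0 ≤ δJ := by rw [hδJ]; nlinarith
  have h1C : 0 ≤ 1 + CLip d ℓ := by linarith [one_le_CLip d ℓ]
  have hJ : 0 ≤ CJG d ℓ (trBasis N) 1 (thetaL d ℓ ϑF) (w13 s) δJ := CJG_nonneg (d := d) (ℓ := ℓ) (trBasis N) (p := (1 : ℝ)) (thetaL_nonneg d ℓ hϑF) hws δJ
  have hc0 : (0 : ℝ) ≤ rowConst261 (@geo9Y d ℓ hd hL b₀ b₁ Mstar) 1 := rowConst261_nonneg _ _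
  set B3d : ℝ := ((d : ℝ) + 1) * ((1 + CLip d ℓ) * (Bi * L₀) * ((CJG d ℓ (trBasis N) 1 (thetaL d ℓ ϑF) (w13 s) δJ) * L₀) * rowConst261 (@geo9Y d ℓ hd hL b₀ b₁ Mstar) 1) with hB3ddef
  refine ⟨max M₀ (max Mg ML), ?_⟩
  intro x hM α₀ hα ha U hU hU'
  have hrowx : ∀ x : MemberY d ℓ hd hL b₀ b₁ Mstar, max M₀ (max Mg ML) ≤ (geo9Y x).M → RowSum (toB6 (geo9Y x) 1 (H x)) 1 (rowConst261 (@geo9Y d ℓ hd hL b₀ b₁ Mstar) 1) :=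
    fun x hM y => hrow x (((le_max_right _ _).trans (le_max_right _ _)).trans hM) y
  have hFa' : ∀ x : MemberY d ℓ hd hL b₀ b₁ Mstar, max M₀ (max Mg ML) ≤ (geo9Y x).M → Facts347 (geo9Y x) 1 (H x) (exp261 (@geo9Y d ℓ hd hL b₀ b₁ Mstar) (δ44 - δ₃) (1 - 1 / 2)) (δ44 - δ₃) (1 / 2) L₀ :=
    fun x hM => hFa x (((le_max_left _ _).trans (le_max_right _ _)).trans hM)
  have hF' := fun (x : MemberY d ℓ hd hL b₀ b₁ Mstar) (hM : max M₀ (max Mg ML) ≤ (geo9Y x).M) (α₀ : ℝ) hα ha U hU hU' => hF x ((le_max_left _ _).trans hM) α₀ hα ha U hU hU'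
  have h44m' := fun (x : MemberY d ℓ hd hL b₀ b₁ Mstar) (hM : max M₀ (max Mg ML) ≤ (geo9Y x).M) (α₀ : ℝ) hα ha U hU hU' => h44m x ((le_max_left _ _).trans hM) α₀ hα ha U hU hU'
  -- the constant bound with the member's `L ≤ ℓ + 1`
  have hB₃ : ∀ x : MemberY d ℓ hd hL b₀ b₁ Mstar, ((d : ℝ) + 1) * ((1 + CLip d ℓ) * (Bi * L₀) * (CJG d ℓ (trBasis N) 1 (thetaL d ℓ ϑF) (w13 s) δJ * (geo9Y x).L) * rowConst261 (@geo9Y d ℓ hd hL b₀ b₁ Mstar) 1) ≤ B3d := by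
    intro x; rw [hB3ddef]
    have hLx : (geo9Y x).L ≤ L₀ := (geo9Y_scalars x).2.1
    gcongr
  have h1 : δ₃ ≤ δ44 - 1 / 2 * (δ44 - δ₃) := by linarith
  have h2 : δ₃ + 1 ≤ δJ - 1 / 2 * (δ44 - δ₃) := by rw [hδJ]; linarith
  exact ⟨dgDHd_of_pins H bI hβ1 hbI0 hGR c (M₀ := max M₀ (max Mg ML)) (a₀ := a₀) hϑF hF' hFa' hrowx w13 hw13₀ hw13₁ hs0 hs1 hws bH13 hbH13 𝔬A 𝔬12 hDvco12 𝔡A h𝔡As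
      (δ₀ := δ44) (δJ := δJ) (B₃ := B₃) (δ₃ := δ₃) hBi hc0 hδJ0 hδ₃ h1 h2 (fun x => (hB₃ x).trans hB3d) h44m' x hM α₀ hα ha U hU hU',
    dgDH_of_pins H bI hβ1 hbI0 hGR c (M₀ := max M₀ (max Mg ML)) (a₀ := a₀) hϑF hF' hFa' hrowx w13 hw13₀ hw13₁ hs0 hs1 hws bH13 hbH13 𝔬A 𝔬12 hDvco12 𝔡A h𝔡As h𝔡Ad hblk12 hblkY12 hDco12
      (δ₀ := δ44) (δJ := δJ) (B₃ := B3d) (δ₃ := δ₃) (B₃p := B₃) hBi hc0 hδJ0 hδ₃ h1 h2 hB₃ hB3p h44m' x hM α₀ hα ha U hU hU'⟩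

end Summit.QuantumFields.YangMills.BalabanUVNodes.N06DgLegAtPinsPhysRU

end
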